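import Literature.AlgebraicTopology.SingularHomology.IteratedSuspensionIsomorphism
import Literature.AlgebraicTopology.SingularHomology.TubeCollapseCohomology
import Literature.AlgebraicTopology.SingularHomology.CohomologyRingChange
import Literature.AlgebraicTopology.SingularHomology.UniversalCoefficientsField
import Literature.AlgebraicTopology.SingularHomology.IntersectionForm
import Literature.AlgebraicTopology.SingularHomology.CollapseMap
import Literature.AlgebraicTopology.SingularHomology.SphereHomology
import Literature.AlgebraicTopology.SingularHomology.ExcisionMayerVietorisProofs
import Literature.Topology.FourManifolds.LatticeForms
import Mathlib.Algebra.Field.ZMod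
import HarnessLib

/-!
# The Wu class of a tubed compact pair vanishes: `Sq` into the top degree is zero

The core of the Wu-class proof that the intersection form of a `π`-manifold bounded by a
homotopy sphere is even (A. Kosinski, *Differential Manifolds* (1993), Ch. X, Prop. (3.1),
p. 205, evenness half; J. Milnor, J. Stasheff, *Characteristic classes* (1974), §18 with
Thm. 11.14: for a stably framed manifold all Stiefel–Whitney classes, hence all Wu classes,
vanish; W. Browder, *Surgery on simply-connected manifolds* (1972), III §1), isolated as a
statement of pure algebraic topology about a compact Hausdorff space — so that it applies
verbatim to EACH connected component of a possibly disconnected manifold with boundary, and to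
closed components (`X = P`), which is how the evenness for an arbitrary s-parallelizable
null-cobordism has to be assembled.

**Setting** (`TubeCollapse.lean`, `TubeCollapseCohomology.lean`): `P` compact Hausdorff,
`X ⊆ P` open and nonempty, `X⁺ = OnePoint X` (for `X` the interior of a compact manifold with
boundary `P` this is the closed model `P ∪ cone(∂P)`; for `X = P` closed it is `P ⊔ {∞}`), and a
closed TUBE `t : P × [0,1]ᴺ ↪ 𝕊ⁿ⁺¹⁺ᴺ` (continuous, injective) whose open part
`t (X × (0,1)ᴺ)` is open; `g : 𝕊ⁿ⁺¹⁺ᴺ → Sᴺ X⁺` the collapse (`tubeCollapse.map`).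

* `steenrodSqLower_eq_zero_of_tube` — **if `Hⁿ⁺¹(X⁺; ℤ/2)` has at most one nonzero element,
  then `Sq : Hᵖ(X⁺; ℤ/2) → Hⁿ⁺¹(X⁺; ℤ/2)` (`p + p = n + 1`, the cup square `Sq_0 = Sqᵖ`) is
  zero.** Proof (Milnor–Stasheff §18): `T = g^* ∘ Σᴺ : Hⁿ⁺¹(X⁺) → Hⁿ⁺¹⁺ᴺ(𝕊)` is nonzero
  (`tubeCollapse.exists_map_ne_zero`: excision at a point of the open tube, with
  `Hⁿ⁺¹⁺ᴺ(𝕊 ∖ pt; ℤ/2) = 0 ≠ Hⁿ⁺¹⁺ᴺ(𝕊; ℤ/2)`), hence nonzero on THE nonzero element; and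
  `T ∘ Sq = Sq ∘ (g^* Σᴺ)` on `Hᵖ` (`Sq` is stable, `suspensionIsoN_steenrodSqLower`, and natural)
  factors through `Hᵖ⁺ᴺ(𝕊ⁿ⁺¹⁺ᴺ; ℤ/2) = 0`.
* `even_kroneckerPairing_cupProduct_self_of_steenrodSqLower_eq_zero`,
  `isEven_intersectionForm_of_steenrodSqLower_eq_zero` — from `Sq = 0` into the top degree,
  `⟨a ⌣ a, z⟩` is even for every integral class `a ∈ Hᵖ(Y; ℤ)` and EVERY `z ∈ Hₙ₊₁(Y; ℤ)`
  (reduction mod `2` is multiplicative with kernel `2H`, `CohomologyRingChange.lean`); in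
  particular the intersection form of any `ℤ`-orientation of `Y` is even.
* The cohomology of spheres over a field used above (`isZero_singularCohomology_of_field`,
  `not_isZero_singularCohomology_sphere_top_of_field`,
  `isZero_singularCohomology_sphere_compl_singleton_of_ne_zero`), from the tree's homology of
  spheres and universal coefficients over a field, and `Sq_0 x = x ⌣ x` in the lower indexing
  (`steenrodSqLower_zero_eq_cupProduct_self`).

The hypothesis "at most one nonzero element in `Hⁿ⁺¹(X⁺; ℤ/2)`" holds for `X` the interior of
a compact CONNECTED manifold with nonempty boundary
(`Literature.Topology.FourManifolds.NullCobordism.eq_of_ne_zero_singularCohomology_closedModel_top`,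
`ClosedModelTopHomologyModTwo.lean`, chart-free) and for `X = P` a closed connected manifold
(Hatcher Thm. 3.26). Everything here is proved; no definition of a notion, no named fact (D-0026).
Written for the fact seat of
`Literature.Topology.FourManifolds.HomotopySphere.exists_mem_signatureSet_iff_eight_dvd`
(Kervaire–Milnor 1963, p. 530), whose divisibility half needs evenness for every
s-parallelizable null-cobordism (`HomotopySphere.eight_dvd_of_mem_signatureSet_of_isEven`).

## References

* J. Milnor, J. Stasheff, *Characteristic classes*, Princeton UP 1974, §18 pp. 215–216
  (Pontryagin–Thom collapse), Thm. 11.14 (Wu's formula). [MilnorStasheff1974]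
* A. Kosinski, *Differential Manifolds*, Academic Press 1993, Ch. X Prop. (3.1) p. 205.
  [Kosinski1993]
* A. Hatcher, *Algebraic Topology*, CUP 2002, §4.L (Steenrod squares, stability), Thm. 3.2
  (p. 198), Cor. 2.14, §3.E p. 303. [HatcherAT2002]
* M. Kervaire, J. Milnor, *Groups of homotopy spheres I*, Ann. of Math. 77 (1963), §7, p. 528
  and p. 530. [KervaireMilnorAnnals1963]
-/

noncomputable section

open CategoryTheory CategoryTheory.Limits unitInterval Set Function OnePoint
open Literature.AlgebraicTopology.Homotopy
open _root_.Topology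

universe u v

namespace Literature.AlgebraicTopology.SingularHomology

/-! ### Cohomology of spheres over a field -/

section Field

variable (F : Type v) [Field F]

/-- **Over a field, `Hₙ(X; F) = 0` implies `Hⁿ(X; F) = 0`** (universal coefficients over a
field: the Kronecker map `Hⁿ(X; F) → Hom(Hₙ(X; F), F)` is injective, Hatcher Thm. 3.2 with
p. 198). [cite: HatcherAT2002, §3.1 Thm. 3.2 (p. 198)] -/
theorem isZero_singularCohomology_of_field {X : Type u} [TopologicalSpace X] (n : ℕ)
    (h : IsZero (singularHomology F F X n)) : IsZero (singularCohomology F F X n) := by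
  haveI := ModuleCat.subsingleton_of_isZero h
  haveI : Subsingleton (singularHomology F F X n →ₗ[F] F) :=
    ⟨fun f g => LinearMap.ext fun x => by rw [Subsingleton.elim x 0, map_zero, map_zero]⟩
  haveI : Subsingleton (singularCohomology F F X n) :=
    (kroneckerPairing_bijective_of_field F X n).1.subsingleton
  exact ModuleCat.isZero_of_subsingleton _

/-- **`Hᵏ(𝕊ᴹ; F) = 0` for `k ≠ 0, M`** over a field (Hatcher Cor. 2.14 with Thm. 3.2).
[cite: HatcherAT2002, Cor. 2.14 and Thm. 3.2] -/
theorem isZero_singularCohomology_sphere_of_field {M k : ℕ} (hk0 : k ≠ 0) (hkM : k ≠ M) :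
    IsZero (singularCohomology F F (Metric.sphere (0 : EuclideanSpace ℝ (Fin (M + 1))) 1) k) :=
  isZero_singularCohomology_of_field F k (isZero_singularHomology_sphere_holds F F hk0 hkM)

/-- **`Hᴹ(𝕊ᴹ; F) ≠ 0` for `M ≥ 1`** over a field: `H_M(𝕊ᴹ; F) ≅ F` (Hatcher Cor. 2.14) and
`dim Hᴹ = dim H_M` (Thm. 3.2 with p. 198). [cite: HatcherAT2002, Cor. 2.14 and Thm. 3.2] -/
theorem not_isZero_singularCohomology_sphere_top_of_field {M : ℕ} (hM : 1 ≤ M) :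
    ¬ IsZero (singularCohomology F F (Metric.sphere (0 : EuclideanSpace ℝ (Fin (M + 1))) 1) M) := by
  intro h
  obtain ⟨e⟩ := nonempty_singularHomology_sphere_iso_holds F F hM
  have h1 : Module.finrank F (singularCohomology F F (Metric.sphere (0 : EuclideanSpace ℝ (Fin (M + 1))) 1) M) = 1 := by
    rw [finrank_singularCohomology_eq_bettiNumber_of_field, bettiNumber, e.toLinearEquiv.finrank_eq,
      (ULift.moduleEquiv (R := F) (M := F)).finrank_eq, Module.finrank_self]
  haveI := ModuleCat.subsingleton_of_isZero h
  rw [Module.finrank_zero_of_subsingleton] at h1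
  exact zero_ne_one h1

/-- **`Hᵏ(𝕊ᴹ ∖ {s}; F) = 0` for `k ≠ 0`**: a punctured sphere is contractible. [cite: HatcherAT2002, §2.1 (homotopy invariance), Cor. 2.14] -/
theorem isZero_singularCohomology_sphere_compl_singleton_of_ne_zero {M k : ℕ} (hk : k ≠ 0)
    (s : Metric.sphere (0 : EuclideanSpace ℝ (Fin (M + 1))) 1) :
    IsZero (singularCohomology F F ({s}ᶜ : Set (Metric.sphere (0 : EuclideanSpace ℝ (Fin (M + 1))) 1)) k) :=
  haveI := contractibleSpace_sphere_compl_singleton s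
  isZero_singularCohomology_of_contractibleSpace F F _ hk

end Field

/-! ### `Sq_0` is the cup square -/

section SqZero

variable {R : Type v} [CommRing R] [CharP R 2] {Y : Type u} [TopologicalSpace Y]

/-- **`Sq_0 x = x ⌣ x`** in Steenrod's lower indexing with explicit output degree: for
`x ∈ Hᵖ(Y; R)` and `p + p = n`, `steenrodSqLower Y p n 0 x = x ⌣ x` (`steenrodSq_self`:
`Sqᵖ x = x ⌣ x`, and `Sqᵖ = Sq_{p-p}`). [cite: HatcherAT2002, §4.L (property (5) of Sq)] -/
theorem steenrodSqLower_zero_eq_cupProduct_self {p n : ℕ} (h : p + p = n)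
    (x : singularCohomology R R Y p) : steenrodSqLower Y p n 0 x = cupProduct h x x := by
  subst h
  have h1 := steenrodSq_self x
  change steenrodSqLower Y p (p + p) (p - p) x = _ at h1
  rwa [Nat.sub_self] at h1

end SqZero

/-! ### The Wu class of a tubed pair vanishes -/

section Tube

variable {P : Type} [TopologicalSpace P] [CompactSpace P] [T2Space P] {X : Set P}

/-- **`Sq` into the top degree vanishes on the one-point compactification of a tubed open
subset** (Milnor–Stasheff 1974, §18 with Thm. 11.14; Kosinski 1993, X.(3.1)): `P` compact
Hausdorff, `X ⊆ P` open nonempty, `Hⁿ⁺¹(X⁺; ℤ/2)` with at most one nonzero element,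
`t : P × [0,1]ᴺ ↪ 𝕊ⁿ⁺¹⁺ᴺ` a closed tube whose open part over `X` is open. Then
`Sq : Hᵖ(X⁺; ℤ/2) → Hⁿ⁺¹(X⁺; ℤ/2)` is zero for `p + p = n + 1`. See the module docstring.
[cite: MilnorStasheff1974, §18 pp. 215–216 and Thm. 11.14] [cite: Kosinski1993, Ch. X, Prop. (3.1) (p. 205)] -/
theorem steenrodSqLower_eq_zero_of_tube (hX : IsOpen X) (hXne : X.Nonempty) {n p : ℕ}
    (hp : p + p = n + 1)
    (hV : ∀ a b : singularCohomology (ZMod 2) (ZMod 2) (OnePoint X) (n + 1),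
      a ≠ 0 → b ≠ 0 → a = b)
    {N M : ℕ} (hM : M = n + 1 + N) (t : P × (Fin N → I) → Metric.sphere (0 : EuclideanSpace ℝ (Fin (M + 1))) 1) (ht : Continuous t)
    (hinj : Injective t) (hTo : IsOpen (tubeCollapse.openTube X t))
    (y : singularCohomology (ZMod 2) (ZMod 2) (OnePoint X) p) :
    steenrodSqLower (OnePoint X) p (n + 1) 0 y = 0 := by
  subst hM
  haveI : Fact (Nat.Prime 2) := ⟨Nat.prime_two⟩
  haveI : Nonempty (OnePoint X) := ⟨∞⟩
  haveI : NeZero (n + 1) := ⟨Nat.succ_ne_zero n⟩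
  haveI : NeZero p := ⟨by omega⟩
  obtain ⟨x₀, hx₀⟩ := hXne
  -- the collapse map of the tube and the nonzero map `T = g^* ∘ Σᴺ`
  obtain ⟨τ, hτ⟩ := tubeCollapse.exists_cubeCoord (X := X) ht hinj hTo
  let g : C(Metric.sphere (0 : EuclideanSpace ℝ (Fin (n + 1 + N + 1))) 1, suspN (OnePoint X) N) :=
    ⟨tubeCollapse.map X ht hinj τ, tubeCollapse.continuous_map hX ht hinj hTo hτ⟩
  obtain ⟨y₁, hy₁⟩ := tubeCollapse.exists_map_ne_zero (ZMod 2) hX ⟨x₀, hx₀⟩ ht hinj hTo hτ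
    (n + 1 + N)
    (fun s => isZero_singularCohomology_sphere_compl_singleton_of_ne_zero (ZMod 2) (by omega) s)
    (not_isZero_singularCohomology_sphere_top_of_field (ZMod 2) (by omega))
  change singularCohomology (ZMod 2) (ZMod 2) (suspN (OnePoint X) N) (n + 1 + N) at y₁
  change singularCohomology.map (ZMod 2) (ZMod 2) g (n + 1 + N) y₁ ≠ 0 at hy₁
  let Φ := suspensionIsoN (ZMod 2) (ZMod 2) (OnePoint X) (n + 1) N
  obtain ⟨v₀, rfl⟩ : ∃ v, Φ.hom v = y₁ :=
    ⟨Φ.inv y₁, by rw [← ModuleCat.comp_apply, Φ.inv_hom_id]; rfl⟩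
  have hv₀ : v₀ ≠ 0 := fun h => hy₁ (by rw [h, map_zero, map_zero])
  -- `T (Sq y) = Sq (g^* Σᴺ y) = 0`, so `Sq y ≠ v₀`, so `Sq y = 0`
  by_contra hz
  apply hy₁
  rw [← hV _ _ hz hv₀, suspensionIsoN_steenrodSqLower (OnePoint X) (n + 1) 0 y N,
    steenrodSqLower_map]
  have h0 : singularCohomology.map (ZMod 2) (ZMod 2) g (p + N)
      ((suspensionIsoN (ZMod 2) (ZMod 2) (OnePoint X) p N).hom y) = 0 := by
    haveI := ModuleCat.subsingleton_of_isZero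
      (isZero_singularCohomology_sphere_of_field (ZMod 2) (M := n + 1 + N) (k := p + N)
        (by omega) (by omega))
    exact Subsingleton.elim _ _
  rw [h0, map_zero]

end Tube

/-! ### From `Sq = 0` to evenness of cup squares -/

section Even

variable {Y : Type u} [TopologicalSpace Y]

/-- **If `Sq : Hᵖ(Y; ℤ/2) → Hⁿ(Y; ℤ/2)` vanishes then `⟨a ⌣ a, z⟩` is even** for every
`a ∈ Hᵖ(Y; ℤ)` and every `z ∈ Hₙ(Y; ℤ)` (`p + p = n`): the reduction of `a ⌣ a` modulo `2` is
`ā ⌣ ā = Sq ā = 0`, so `a ⌣ a ∈ 2 Hⁿ(Y; ℤ)` (Hatcher §3.E p. 303). [cite: HatcherAT2002, §3.E p. 303 and §4.L] [cite: MilnorStasheff1974, Thm. 11.14] -/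
theorem even_kroneckerPairing_cupProduct_self_of_steenrodSqLower_eq_zero {p n : ℕ}
    (h : p + p = n)
    (hsq : ∀ yb : singularCohomology (ZMod 2) (ZMod 2) Y p, steenrodSqLower Y p n 0 yb = 0)
    (a : singularCohomology ℤ ℤ Y p) (z : singularHomology ℤ ℤ Y n) :
    Even (kroneckerPairing ℤ ℤ Y n (cupProduct h a a) z) := by
  have hρ : singularCohomology.ringChange (Int.castRingHom (ZMod 2)) Y n (cupProduct h a a) = 0 := by
    rw [singularCohomology.ringChange_cupProduct, ← steenrodSqLower_zero_eq_cupProduct_self h]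
    exact hsq _
  obtain ⟨b, hb⟩ := exists_eq_add_self_of_ringChange_eq_zero _ hρ
  exact ⟨_, by rw [hb, map_add, LinearMap.add_apply]⟩

/-- **If `Sq : Hᵏ(Y; ℤ/2) → Hⁿ(Y; ℤ/2)` vanishes then the intersection form of every
`ℤ`-orientation of `Y` in dimension `n = k + k` is even** (`Q(x, x) = ⟨a ⌣ a, [Y]⟩`).
Kosinski 1993, X.(3.1) (evenness half) in the Wu-class form. [cite: Kosinski1993, Ch. X, Prop. (3.1) (p. 205)] [cite: MilnorStasheff1974, Thm. 11.14] -/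
theorem isEven_intersectionForm_of_steenrodSqLower_eq_zero {k n : ℕ} (hk : k + k = n)
    (μ : HomologicalOrientation ℤ Y n)
    (hsq : ∀ yb : singularCohomology (ZMod 2) (ZMod 2) Y k, steenrodSqLower Y k n 0 yb = 0) :
    (intersectionForm hk μ).IsEven := by
  intro xq
  obtain ⟨a, rfl⟩ := freeCohomology.mk_surjective xq
  rw [intersectionForm_mk_mk, cupPairing_apply]
  exact even_kroneckerPairing_cupProduct_self_of_steenrodSqLower_eq_zero hk hsq a _

end Even

end Literature.AlgebraicTopology.SingularHomology
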